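import Summits.QuantumFields.YangMills.Theorems.BalabanUVNodesK0Stub1DoubleBarFibreAtRecordClosed
import Summits.QuantumFields.YangMills.Theorems.BalabanUVNodesK0Stub1CritOnFibreGaugeCovariance
import Summits.QuantumFields.YangMills.Theorems.UnitScaleTiltHalvingCompetitorMapFramesSmooth
import Summits.QuantumFields.YangMills.Theorems.UnitScaleTiltProp8ChartDiff
import Literature.MathematicalPhysics.QuantumFieldTheory.Balaban1983to89.Node00.CriticalOnFibre
import Literature.MathematicalPhysics.QuantumFieldTheory.Balaban1983to89.B14Eq16FaddeevPopov
import Literature.MathematicalPhysics.QuantumFieldTheory.Balaban1983to89.B12RTGaugeInvariance254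
import HarnessLib

/-!
# K0⁷ STUB 1 (`stub_prop8StepCoP13`), sub-target S4a — **THE CONFIGURATION-LEVEL SOCKET OF THE ♭ ROAD: the Wilson action is STATIONARY along every charted curve with
# pinned double-bar data through a fibre-critical charted point** — the record's criticality on NODE 00's multi-level (0.4) fibre, transported by the `SU(N)` gauge
# family of `…K0Stub1DoubleBarFibreAtRecordClosed` (the curve `t ↦ (U t)^{h t}` runs INSIDE the fibre, `𝔄` is gauge-blind, `t ↦ h t` is differentiable by UST's
# ✓`HalvingCompetitorMapFramesSmooth`), file 5 of this seat's g7 ♭-road bricks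

Cell `pub-ymgap`, width seat `pub-ymgap-k0-s1-w1` g7 (CLAIM-4).  `--kind proof --supports stmt-QuantumFields-20541 --as helper`; count-neutral.  [15] = [Balaban1985Variational];
[B7AVG] = [Balaban1985Averaging]; [B6] = [Balaban1984PropagatorsII]; [I] = [Balaban1987RG1]; [III] = [Balaban1988Convergent].

WHY.  On the (R1′) ♭ road the S4a socket `h127rec` («`⟨δ, Δ₁A′₁ + W⟩ = 0` for every 𝔰𝔲(N)-valued `δ` in print's multi-level kernel») is the derivative at `t = 0` of
`t ↦ 𝔄(e^{iη·chart♭(A′₁ + tδ)})` through S4b's (157) `HasFDerivAt` (k0-s1-w2 C″∕D″) — PROVIDED that derivative vanishes.  It does, by the record's criticality, but the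
record is critical on the SINGLE-bar (0.4) fibre `{U | Ū^j(U) = Ū^j(U₁) on Λ_j ∀ j}` (`Node00.IsCritOnFibre`, curve form), while the charted curve has constant DOUBLE-bar data.
Files 1–4 of this seat close the gap at the configuration level: `∃ h t ∈ SU(N)^{sites}` with `(U t)^{h t}` IN the fibre and the uniform-choice clause (each `h t x` is `1` or ONE
fixed accumulated-frame quotient along `t`).  THIS FILE adds the calculus: (i) the frame quotient is differentiable in a COMPLEX parameter (UST ✓`differentiableAt_coe_accFrames_quotient`,
near-flatness under the `Ω`-blocks from the weighted ball, file 4's §4) and so is its inverse (✓`Prop8Chart.differentiableAt_coe_inv`), hence `t ↦ ↑(h t x)`, `t ↦ ↑(h t x)⁻¹` are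
ℝ-differentiable along the real curve; (ii) so `γ t := (U t)^{h t}` is a bondwise-differentiable curve with `γ 0 = U 0` (`h 0 = 1`: at `t = 0` the two frame families coincide)
lying in the fibre for ALL `t`; (iii) criticality gives `(𝔄 ∘ γ)′(0) = 0`, and `𝔄(γ t) = 𝔄(U t)` (✓`B14Eq16FaddeevPopov.wilsonAction4_gaugeAct'`).  Criticality is taken in the
(2.3)-LETTERED curve form (fibre = equal `avgFamily (avOfRecord F N K)` on the `LamBond` bonds of every level `≤ k`) — implied by `Node00.IsCritOnFibre F N K 𝔹 …` for every
determining set `𝔹` whose bonds are (2.3) index bonds (§3; the (ii)-edition of `B15.bondsOf` pending per ME #35 is exactly that reading).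

WHAT IS PROVED (sorry-free; no definition; axioms standard; `F : T4Family`, `P = F.P K`, `N ≥ 1`).
* §1 `eventually_ofReal` · `differentiableAt_ofReal_comp` · `coe_su_inv_eq_coe_units_inv` · ★ `differentiableAt_coe_accFrames_quotient_of_ball` (UST's
  frame-quotient differentiability with `hflat`∕`hbudget` DISCHARGED on the weighted ball: `s_j = 2R·L^{−(j+1)}`, `60800ℓ²R ≤ 1`).
* §2 ★★★★ `hasDerivAt_wilsonAction4_zero_of_flatChart_critical` — `D.k = k`, collar, `IsLevWeight` ball with budgets `12800ℓ²LR ≤ 1`, `60800ℓ²R ≤ 1`, `60ℓ²LR < δ_N`; a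
  COMPLEX charted family `A : ℂ → (bonds → M_N(ℂ))` ℂ-differentiable at `0`, in the ball and with the double-bar data of `A 0` for `z` near `0`; `SU(N)` readings `U t = e^{iηA(t)}` for
  real `t` near `0`; `U 0` critical along every bondwise-differentiable curve through it whose record averages agree with those of `U 0` on every (2.3) index bond of every
  level `≤ k` ⟹ **`HasDerivAt (t ↦ 𝔄(U t)) 0 0`**.
* §3 ★★★ `hasDerivAt_wilsonAction4_zero_of_flatChart_isCritOnFibre` — the same from `Node00.IsCritOnFibre F N K 𝔹 (avgFamily (avOfRecord F N K) (U 0)) (U 0)` for any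
  determining set `𝔹` with `bondsOf (𝔹 j) ⊆ {(2.3) index bonds of level j ≤ k}`.
* §4 `add_eq_zero_of_hasDerivAt_zero` — stationarity + the (157) split ⇒ `q′(0) + V′(0) = 0` (the ♭ edition of dag-n07-w1's `inner_hessOpAt_add_eq_zero_of_isCritOnFibre`: stationarity
  is the INPUT here, so p632841's §1 `hasDerivAt_inner_hessOpAt_line` + S4b's `hV` give `⟪δ, Δ₁A₀⟫ + v = 0` = `h127rec` with `T = 0`).
HONEST SCOPE.  First-order calculus + bookkeeping over files 1–4, UST's landed smoothness∕units lemmas and the tree's gauge invariance of `𝔄`; the (157) `HasFDerivAt` that turns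
this stationarity into `h127rec`∕`h128` is S4b's (k0-s1-w2 C″∕D″) and the identification of the charted curve's pinned double-bar data is (49)♭ (k0-s1-w4 p629502 + file 2 §0);
NO estimate of Bałaban's proved or asserted; `stub_prop8StepCoP13` ∕ K0⁷ NOT closed; N07 NOT discharged; counts unmoved (28∕28 · 5∕27); one finite 𝕋⁴ programme at fixed ε — R4
closes the conditional finite-𝕋⁴ rung `BalabanLadder.UV` only, never the summit; the YM mass gap (Clay) is NOT proved by any of this; nothing continuum ∕ ℝ⁴ ∕ OS.  No `sorry`, no
`def`, no `instance`, no `notation`.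

References: [15] T. Bałaban, CMP **102** (1985) 277–309 ((5)–(6) p.278, (20) p.281, (44)–(49) p.285, (127)–(128) p.297, (152) p.301, (156)–(157) p.302); [B7AVG] CMP **98**
(1985) 17–51 ((11)–(13) p.19, (92) p.31, (97)–(100) p.32, (110) p.34); [B6] CMP **96** (1984) 223–250 ((2.1)–(2.4) p.224); [I] CMP **109** (1987) 249–301 ((0.2) p.252, (0.4),
(0.11) p.253); [III] CMP **119** (1988) 243–285 ((0.2) p.244, (2.10)–(2.12) p.256).
-/

set_option autoImplicit false

noncomputable section

open scoped BigOperators Matrix.Norms.L2Operator Topology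
open Filter

namespace Summit.QuantumFields.YangMills.Theorems.K0Stub1FlatChartCriticalityTransfer

open Literature.MathematicalPhysics.QuantumFieldTheory.Balaban1983to89
open T4Continuum BlockAveraging ExpMeanLog
open B10Eq27TorusAxialLog (gaugeActT gaugeActT_apply unitsField toUField suIncl val_suIncl)
open B5Eq118OneStroke (iterBlockOf)
open B15DeterminingSets (embIter avgFamily bondsOf DetSet AgreeOn)
open B6SectADomainsV1 (Domains)
open B6SectAOperatorsV1 (BondIdx)
open Node00 (avOfRecord IsCritOnFibre isCritOnFibre_iff_hasDerivAt_zero)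
open Summit.QuantumFields.YangMills.Theorems.Prop8Chart (expCfg differentiableAt_coe_expCfg differentiableAt_coe_inv)
open Summit.QuantumFields.YangMills.Theorems.Prop8ChartDoubleBar (vframeU dbarIterU)
open Summit.QuantumFields.YangMills.Theorems.K0FlatCubeOpsTextP (IsLevWeight)
open Summit.QuantumFields.YangMills.Theorems.HalvingCompetitorMapFramesSmooth (differentiableAt_coe_accFrames_quotient)
open Summit.QuantumFields.YangMills.Theorems.K0Stub1DoubleBarFibreAtRecordClosed (norm_expCfg_sub_one_le_of_mem_Om exists_suGauge_family_avgFamily_eq_closed)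
open Summit.QuantumFields.YangMills.Theorems.K0Stub1CritOnFibreGaugeCovariance (coe_gaugeAct_apply')

variable {P : Params} {N : ℕ}

/-! ## §1  Calculus and bookkeeping helpers -/

/-- a property holding near `0 ∈ ℂ` holds for real `t` near `0`. [folklore] -/
theorem eventually_ofReal {p : ℂ → Prop} (h : ∀ᶠ z in 𝓝 (0 : ℂ), p z) : ∀ᶠ t : ℝ in 𝓝 0, p (↑t : ℂ) :=
  (Complex.continuous_ofReal.tendsto' (0 : ℝ) (0 : ℂ) Complex.ofReal_zero).eventually h

/-- a ℂ-differentiable function restricted to the real line is ℝ-differentiable. [folklore] -/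
theorem differentiableAt_ofReal_comp {V : Type*} [NormedAddCommGroup V] [NormedSpace ℂ V] {f : ℂ → V} (hf : DifferentiableAt ℂ f 0) :
    DifferentiableAt ℝ (fun t : ℝ => f (t : ℂ)) 0 := by
  have hf' : DifferentiableAt ℝ f ((0 : ℝ) : ℂ) := by rw [Complex.ofReal_zero]; exact hf.restrictScalars ℝ
  exact hf'.comp (0 : ℝ) Complex.ofRealCLM.differentiableAt

/-- if an `SU(N)` element and a unit of `M_N(ℂ)` have the same matrix, so do their inverses. [cite: Balaban1985Averaging, (19) p.21] -/
theorem coe_su_inv_eq_coe_units_inv {s : Matrix.specialUnitaryGroup (Fin N) ℂ} {u : (Matrix (Fin N) (Fin N) ℂ)ˣ}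
    (h : (s : Matrix (Fin N) (Fin N) ℂ) = (u : Matrix (Fin N) (Fin N) ℂ)) :
    ((s⁻¹ : Matrix.specialUnitaryGroup (Fin N) ℂ) : Matrix (Fin N) (Fin N) ℂ) = ((u⁻¹ : (Matrix (Fin N) (Fin N) ℂ)ˣ) : Matrix (Fin N) (Fin N) ℂ) := by
  have hmul : (u : Matrix (Fin N) (Fin N) ℂ) * ((s⁻¹ : Matrix.specialUnitaryGroup (Fin N) ℂ) : Matrix (Fin N) (Fin N) ℂ) = 1 := by
    rw [← h, ← Submonoid.coe_mul, mul_inv_cancel]; rfl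
  exact (Units.inv_eq_of_mul_eq_one_right hmul).symm

section Frames

variable [NeZero N] (k : ℕ) (D : Domains P) (hDk : D.k = k)

include hDk in
/-- ★ **THE ACCUMULATED-FRAME QUOTIENT OF A CHARTED COMPLEX FAMILY IS ℂ-DIFFERENTIABLE** (UST ✓`differentiableAt_coe_accFrames_quotient` with its near-flatness∕budget
letters DISCHARGED on the weighted ball): `A : ℂ → (bonds → M_N(ℂ))` ℂ-differentiable at `0` with `A 0` in the ball `w₁(b)‖·‖ < R`, `60800ℓ²R ≤ 1`, and the double-bar data of
`e^{iηA z}` those of `e^{iηA 0}` near `0`; `Vf` ANY accumulated-frames function (97).  Then `z ↦ Vf(e^{iηA z})_j(y)·Vf(e^{iηA 0})_j(y)⁻¹` is ℂ-differentiable at `0`, every `j ≤ k`,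
every `y`. [cite: Balaban1985Averaging, (92) p.31, (97)-(100) p.32, (110) p.34; Balaban1984PropagatorsII, (2.2)-(2.3) p.224; Balaban1985Variational, (150)-(152) p.301] -/
theorem differentiableAt_coe_accFrames_quotient_of_ball {w : ℕ → PBond P 0 → ℝ} (hw : IsLevWeight P k D w) {R : ℝ} (hR0 : 0 ≤ R)
    (hRflat : 60800 * (((P.d + 2) * P.L : ℕ) : ℝ) ^ 2 * R ≤ 1)
    (Vf : GaugeField P 0 (Matrix (Fin N) (Fin N) ℂ)ˣ → (j : ℕ) → Site P j → (Matrix (Fin N) (Fin N) ℂ)ˣ) (hV0 : ∀ W x, Vf W 0 x = 1)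
    (hVs : ∀ (W : GaugeField P 0 (Matrix (Fin N) (Fin N) ℂ)ˣ) (j : ℕ) (y : Site P (j + 1)), Vf W (j + 1) y = Vf W j (emb y) * vframeU (dbarIterU j W) y)
    (A : ℂ → PBond P 0 → Matrix (Fin N) (Fin N) ℂ) (hAdiff : DifferentiableAt ℂ A 0) (hA0 : ∀ b, w 1 b * ‖A 0 b‖ < R)
    (hidx : ∀ᶠ z in 𝓝 (0 : ℂ), ∀ idx : BondIdx D,
      dbarIterU (idx.1.1 : ℕ) (expCfg (((P.L : ℝ)⁻¹) ^ k) (A z)) idx.1.2 = dbarIterU (idx.1.1 : ℕ) (expCfg (((P.L : ℝ)⁻¹) ^ k) (A 0)) idx.1.2)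
    {j : ℕ} (hj : j ≤ D.k) (y : Site P j) :
    DifferentiableAt ℂ (fun z => ((Vf (expCfg (((P.L : ℝ)⁻¹) ^ k) (A z)) j y * (Vf (expCfg (((P.L : ℝ)⁻¹) ^ k) (A 0)) j y)⁻¹ : (Matrix (Fin N) (Fin N) ℂ)ˣ) :
      Matrix (Fin N) (Fin N) ℂ)) 0 := by
  have hL1 : (1 : ℝ) ≤ P.L := by exact_mod_cast P.L_pos
  have hL0 : (0 : ℝ) < P.L := by linarith
  have hℓ1 : (1 : ℝ) ≤ (((P.d + 2) * P.L : ℕ) : ℝ) := by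
    exact_mod_cast Nat.one_le_iff_ne_zero.mpr (Nat.mul_ne_zero (by omega) (by have := P.hL.2; omega))
  have hR1 : R ≤ 1 := by nlinarith [mul_nonneg (by positivity : (0:ℝ) ≤ (((P.d + 2) * P.L : ℕ) : ℝ) ^ 2) hR0]
  -- the near-flatness scale under the `Ω_{j+1}`-blocks
  set s : ℕ → ℝ := fun j => 2 * R * ((P.L : ℝ) ^ (j + 1))⁻¹ with hs
  have hs0 : ∀ j, 0 ≤ s j := fun j => by positivity
  have hbudget : ∀ j, 8 * 3800 * (((P.d + 2) * P.L : ℕ) : ℝ) ^ 2 * (P.L : ℝ) ^ (j + 1) * s j ≤ 1 := by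
    intro j
    have hLj : (P.L : ℝ) ^ (j + 1) ≠ 0 := by positivity
    have hkey : (P.L : ℝ) ^ (j + 1) * s j = 2 * R := by simp only [hs]; field_simp
    calc 8 * 3800 * (((P.d + 2) * P.L : ℕ) : ℝ) ^ 2 * (P.L : ℝ) ^ (j + 1) * s j
        = 8 * 3800 * (((P.d + 2) * P.L : ℕ) : ℝ) ^ 2 * ((P.L : ℝ) ^ (j + 1) * s j) := by ring
      _ = 60800 * (((P.d + 2) * P.L : ℕ) : ℝ) ^ 2 * R := by rw [hkey]; ring
      _ ≤ 1 := hRflat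
  have hflat : ∀ (j : ℕ) (z : Site P (j + 1)), z ∈ D.Om (j + 1) → ∀ b : PBond P 0, iterBlockOf (j + 1) b.src = z → iterBlockOf (j + 1) b.tgt = z →
      ‖((expCfg (((P.L : ℝ)⁻¹) ^ k) (A 0) b : (Matrix (Fin N) (Fin N) ℂ)ˣ) : Matrix (Fin N) (Fin N) ℂ) - 1‖ ≤ s j := by
    intro j z hz b hb _
    have hjk : j + 1 ≤ D.k := by
      by_contra hlt
      rw [D.Om_eq_empty (not_le.mp hlt)] at hz
      exact absurd hz (Finset.notMem_empty _)
    exact norm_expCfg_sub_one_le_of_mem_Om k D hDk hw hR1 hA0 hjk hz b hb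
  have hdiff : ∀ b : PBond P 0, DifferentiableAt ℂ (fun z => ((expCfg (((P.L : ℝ)⁻¹) ^ k) (A z) b : (Matrix (Fin N) (Fin N) ℂ)ˣ) : Matrix (Fin N) (Fin N) ℂ)) 0 :=
    fun b => (differentiableAt_coe_expCfg (((P.L : ℝ)⁻¹) ^ k) b (A 0)).comp 0 hAdiff
  exact ((differentiableAt_coe_accFrames_quotient D Vf hV0 hVs (expCfg (((P.L : ℝ)⁻¹) ^ k) (A 0)) (fun z => expCfg (((P.L : ℝ)⁻¹) ^ k) (A z)) 0 hidx s hs0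
    hbudget hflat hdiff j hj).2 y)

end Frames

/-! ## §2  The Wilson action is stationary along charted curves with pinned double-bar data through a fibre-critical point -/

section Transfer

open T4Continuum (T4Family)

variable (F : T4Family) (N : ℕ) [NeZero N] (K k : ℕ) (D : Domains (F.P K)) (hDk : D.k = k)
  (hcollar : ∀ (i : ℕ) (e : PBond (F.P K) (i + 1)), D.LamBond (i + 1) e → ∀ z : Site (F.P K) i, (blockOf z = e.src ∨ blockOf z = e.tgt) → z ∈ D.Om i)

include hDk hcollar in
/-- ★★★★ **THE CONFIGURATION-LEVEL SOCKET OF THE ♭ ROAD.**  `D` nested (`D.k = k`, collar), `IsLevWeight` ball `w₁(b)‖·‖ < R` with the k-UNIFORM budgets `12800ℓ²LR ≤ 1`,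
`60800ℓ²R ≤ 1`, `60ℓ²LR < δ_N`; a COMPLEX charted family `A : ℂ → (bonds → M_N(ℂ))`, ℂ-differentiable at `0`, lying in the ball and having the DOUBLE-BAR data of `A 0` at the (2.3)
indices for `z` near `0` (at the knit: `A z = chart♭(A′₁ + zδ)`, `δ` in print's kernel, by (49)♭ + file 2 §0); `SU(N)` readings `U t` of `e^{iηA(t)}` (`η = L^{−k}`) for real `t` near
`0`; and CRITICALITY of `U 0` in the (2.3)-lettered curve form: along every curve `γ` of `SU(N)` fields with `γ 0 = U 0`, bondwise differentiable at `0`, whose record averages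
`avgFamily (avOfRecord F N K) (γ t)` agree with those of `U 0` at every (2.3) index bond of every level `≤ k` for all `t`, `(𝔄 ∘ γ)′(0) = 0`.  THEN **`(t ↦ 𝔄(U t))′(0) = 0`**.
Proof: file 4's `exists_suGauge_family_avgFamily_eq_closed` on the cut-off real family ⇒ `h t`; `h 0 = 1` (equal frames at `t = 0`); `γ t := (U t)^{h t}` is in the fibre for all `t`,
bondwise differentiable at `0` (§1 + uniform-choice clause), `γ 0 = U 0`; criticality; `𝔄(γ t) = 𝔄(U t)` near `0`.
[cite: Balaban1985Variational, (5)-(6) p.278, (47)-(49) p.285, (127)-(128) p.297, (156)-(157) p.302; Balaban1985Averaging, (11)-(13) p.19, (92) p.31, (97)-(100) p.32; Balaban1984PropagatorsII, (2.1)-(2.4) p.224; Balaban1988Convergent, (0.2) p.244, (2.10)-(2.12) p.256] -/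
theorem hasDerivAt_wilsonAction4_zero_of_flatChart_critical {w : ℕ → PBond (F.P K) 0 → ℝ} (hw : IsLevWeight (F.P K) k D w) {R : ℝ} (hR0 : 0 ≤ R)
    (hR : 12800 * ((((F.P K).d + 2) * (F.P K).L : ℕ) : ℝ) ^ 2 * ((F.P K).L : ℝ) * R ≤ 1) (hRflat : 60800 * ((((F.P K).d + 2) * (F.P K).L : ℕ) : ℝ) ^ 2 * R ≤ 1)
    (hguard : 60 * ((((F.P K).d + 2) * (F.P K).L : ℕ) : ℝ) ^ 2 * ((F.P K).L : ℝ) * R < deltaSU (Fin N))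
    (A : ℂ → PBond (F.P K) 0 → Matrix (Fin N) (Fin N) ℂ) (hAdiff : DifferentiableAt ℂ A 0)
    (hball : ∀ᶠ z in 𝓝 (0 : ℂ), ∀ b, w 1 b * ‖A z b‖ < R)
    (hidx : ∀ᶠ z in 𝓝 (0 : ℂ), ∀ idx : BondIdx D,
      dbarIterU (idx.1.1 : ℕ) (expCfg ((((F.P K).L : ℝ)⁻¹) ^ k) (A z)) idx.1.2 = dbarIterU (idx.1.1 : ℕ) (expCfg ((((F.P K).L : ℝ)⁻¹) ^ k) (A 0)) idx.1.2)
    (U : ℝ → GaugeField (F.P K) 0 (Matrix.specialUnitaryGroup (Fin N) ℂ))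
    (hU : ∀ᶠ t : ℝ in 𝓝 0, ∀ b, ((U t b : Matrix.specialUnitaryGroup (Fin N) ℂ) : Matrix (Fin N) (Fin N) ℂ) =
      ((expCfg ((((F.P K).L : ℝ)⁻¹) ^ k) (A (↑t : ℂ)) b : (Matrix (Fin N) (Fin N) ℂ)ˣ) : _))
    (hcrit : ∀ γ : ℝ → GaugeField (F.P K) 0 (Matrix.specialUnitaryGroup (Fin N) ℂ), γ 0 = U 0 →
      DifferentiableAt ℝ (fun (t : ℝ) (b : PBond (F.P K) 0) => ((γ t b : Matrix.specialUnitaryGroup (Fin N) ℂ) : Matrix (Fin N) (Fin N) ℂ)) 0 →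
      (∀ (t : ℝ) (j : ℕ) (c : PBond (F.P K) j), j ≤ k → D.LamBond j c → avgFamily (avOfRecord F N K) (γ t) j c = avgFamily (avOfRecord F N K) (U 0) j c) →
      HasDerivAt (fun t => wilsonAction4 (γ t)) 0 0) :
    HasDerivAt (fun t => wilsonAction4 (U t)) 0 0 := by
  set η : ℝ := (((F.P K).L : ℝ)⁻¹) ^ k with hη
  -- one real neighbourhood where the ball, the pinned data and the readings hold
  have hev : ∀ᶠ t : ℝ in 𝓝 0, (∀ b, w 1 b * ‖A (↑t : ℂ) b‖ < R) ∧
      (∀ idx : BondIdx D, dbarIterU (idx.1.1 : ℕ) (expCfg η (A (↑t : ℂ))) idx.1.2 = dbarIterU (idx.1.1 : ℕ) (expCfg η (A 0)) idx.1.2) ∧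
      (∀ b, ((U t b : Matrix.specialUnitaryGroup (Fin N) ℂ) : Matrix (Fin N) (Fin N) ℂ) = ((expCfg η (A (↑t : ℂ)) b : (Matrix (Fin N) (Fin N) ℂ)ˣ) : _)) :=
    ((eventually_ofReal hball).and (eventually_ofReal hidx)).and hU |>.mono fun t h => ⟨h.1.1, h.1.2, h.2⟩
  obtain ⟨ε, hε, hεP⟩ := Metric.eventually_nhds_iff.1 hev
  have h0P := hεP (show dist (0 : ℝ) 0 < ε by rw [dist_self]; exact hε)
  rw [Complex.ofReal_zero] at h0P
  obtain ⟨hA0ball, -, hU0⟩ := h0P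
  -- the cut-off real family: inside the neighbourhood the given one, outside the base point
  classical
  let At : ℝ → PBond (F.P K) 0 → Matrix (Fin N) (Fin N) ℂ := fun t => if dist t 0 < ε then A (t : ℂ) else A 0
  let Ut : ℝ → GaugeField (F.P K) 0 (Matrix.specialUnitaryGroup (Fin N) ℂ) := fun t => if dist t 0 < ε then U t else U 0
  have hAt_in : ∀ t, dist t 0 < ε → At t = A (t : ℂ) := fun t ht => if_pos ht
  have hUt_in : ∀ t, dist t 0 < ε → Ut t = U t := fun t ht => if_pos ht
  have hAt0 : At 0 = A 0 := by rw [hAt_in 0 (by rw [dist_self]; exact hε), Complex.ofReal_zero]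
  have hUt0 : Ut 0 = U 0 := hUt_in 0 (by rw [dist_self]; exact hε)
  have hAt_ball : ∀ t b, w 1 b * ‖At t b‖ < R := by
    intro t b
    by_cases ht : dist t 0 < ε
    · rw [hAt_in t ht]; exact (hεP ht).1 b
    · simp only [At, if_neg ht]; exact hA0ball b
  have hAt_idx : ∀ (t : ℝ) (idx : BondIdx D), dbarIterU (idx.1.1 : ℕ) (expCfg η (At t)) idx.1.2 = dbarIterU (idx.1.1 : ℕ) (expCfg η (A 0)) idx.1.2 := by
    intro t idx
    by_cases ht : dist t 0 < ε
    · rw [hAt_in t ht]; exact (hεP ht).2.1 idx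
    · simp only [At, if_neg ht]
  have hUt_read : ∀ t b, ((Ut t b : Matrix.specialUnitaryGroup (Fin N) ℂ) : Matrix (Fin N) (Fin N) ℂ) = ((expCfg η (At t) b : (Matrix (Fin N) (Fin N) ℂ)ˣ) : _) := by
    intro t b
    by_cases ht : dist t 0 < ε
    · rw [hUt_in t ht, hAt_in t ht]; exact (hεP ht).2.2 b
    · simp only [Ut, At, if_neg ht]; exact hU0 b
  -- the canonical accumulated frames (97)
  let Vf : GaugeField (F.P K) 0 (Matrix (Fin N) (Fin N) ℂ)ˣ → (j : ℕ) → Site (F.P K) j → (Matrix (Fin N) (Fin N) ℂ)ˣ := fun W j =>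
    Nat.rec (motive := fun j => Site (F.P K) j → (Matrix (Fin N) (Fin N) ℂ)ˣ) (fun _ => 1) (fun j Vj y => Vj (emb y) * vframeU (dbarIterU j W) y) j
  have hV0 : ∀ W x, Vf W 0 x = 1 := fun _ _ => rfl
  have hVs : ∀ (W : GaugeField (F.P K) 0 (Matrix (Fin N) (Fin N) ℂ)ˣ) (j : ℕ) (y : Site (F.P K) (j + 1)), Vf W (j + 1) y = Vf W j (emb y) * vframeU (dbarIterU j W) y :=
    fun _ _ _ => rfl
  -- the SU(N) gauge family of file 4
  obtain ⟨h, hch, hfib⟩ := exists_suGauge_family_avgFamily_eq_closed F N K k D hDk hcollar hw hR0 hR hRflat hguard (ι := ℝ) (A₁ := A 0) (A := At)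
    hA0ball hAt_ball (U 0) Ut hU0 hUt_read hAt_idx (fun t => Vf (expCfg η (At t))) (fun _ _ => rfl) (fun _ _ _ => rfl) (Vf (expCfg η (A 0)))
    (fun _ => rfl) (fun _ _ => rfl)
  -- `h 0 = 1`
  have hh0 : h 0 = fun _ => 1 := by
    funext x
    apply Subtype.ext
    rcases hch x with h1 | ⟨j, c, y, -, -, -, -, hval⟩
    · rw [h1 0]; rfl
    · rw [hval 0, hAt0, mul_inv_cancel, Units.val_one]; rfl
  -- the fibre curve
  let γ : ℝ → GaugeField (F.P K) 0 (Matrix.specialUnitaryGroup (Fin N) ℂ) := fun t => GaugeField.gaugeAct (h t) (Ut t)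
  have hγ0 : γ 0 = U 0 := by
    show GaugeField.gaugeAct (h 0) (Ut 0) = U 0
    rw [hh0, hUt0]; exact B12RTGaugeInvariance254.gaugeAct_one' (U 0)
  -- differentiability of the readings along the real curve
  have hUdiff : ∀ b, DifferentiableAt ℝ (fun t : ℝ => ((Ut t b : Matrix.specialUnitaryGroup (Fin N) ℂ) : Matrix (Fin N) (Fin N) ℂ)) 0 := by
    intro b
    have hC : DifferentiableAt ℂ (fun z => ((expCfg η (A z) b : (Matrix (Fin N) (Fin N) ℂ)ˣ) : Matrix (Fin N) (Fin N) ℂ)) 0 :=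
      (differentiableAt_coe_expCfg η b (A 0)).comp 0 hAdiff
    have hRd := differentiableAt_ofReal_comp hC
    refine (Filter.EventuallyEq.differentiableAt_iff ?_).1 hRd
    filter_upwards [Metric.ball_mem_nhds (0 : ℝ) hε] with t ht
    rw [Metric.mem_ball] at ht
    rw [hUt_read t b, hAt_in t ht]
  -- differentiability of the gauge family and of its inverses along the real curve
  have hhdiff : ∀ x : Site (F.P K) 0, DifferentiableAt ℝ (fun t : ℝ => ((h t x : Matrix.specialUnitaryGroup (Fin N) ℂ) : Matrix (Fin N) (Fin N) ℂ)) 0 ∧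
      DifferentiableAt ℝ (fun t : ℝ => (((h t x)⁻¹ : Matrix.specialUnitaryGroup (Fin N) ℂ) : Matrix (Fin N) (Fin N) ℂ)) 0 := by
    intro x
    rcases hch x with h1 | ⟨j, c, y, hj, -, -, -, hval⟩
    · have e1 : (fun t : ℝ => ((h t x : Matrix.specialUnitaryGroup (Fin N) ℂ) : Matrix (Fin N) (Fin N) ℂ)) = fun _ => 1 := funext fun t => h1 t
      have e2 : (fun t : ℝ => (((h t x)⁻¹ : Matrix.specialUnitaryGroup (Fin N) ℂ) : Matrix (Fin N) (Fin N) ℂ)) = fun _ => 1 := by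
        funext t
        have hx1 : h t x = 1 := Subtype.ext (by rw [h1 t]; rfl)
        rw [hx1, inv_one]; rfl
      rw [e1, e2]
      exact ⟨differentiableAt_const _, differentiableAt_const _⟩
    · -- the complex frame quotient `q z = Vf(e^{iηA z})_j(y)·V₁_j(y)⁻¹` and its inverse are ℂ-differentiable at `0`
      have hq : DifferentiableAt ℂ (fun z => ((Vf (expCfg η (A z)) j y * (Vf (expCfg η (A 0)) j y)⁻¹ : (Matrix (Fin N) (Fin N) ℂ)ˣ) : Matrix (Fin N) (Fin N) ℂ)) 0 :=
        differentiableAt_coe_accFrames_quotient_of_ball k D hDk hw hR0 hRflat Vf hV0 hVs A hAdiff hA0ball hidx hj y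
      have hqi := differentiableAt_coe_inv hq
      have hqR := differentiableAt_ofReal_comp hq
      have hqiR := differentiableAt_ofReal_comp hqi
      -- along the cut-off family the values agree near `0`
      have hval' : ∀ t, dist t 0 < ε → ((h t x : Matrix.specialUnitaryGroup (Fin N) ℂ) : Matrix (Fin N) (Fin N) ℂ) =
          (((Vf (expCfg η (A (t : ℂ))) j y * (Vf (expCfg η (A 0)) j y)⁻¹)⁻¹ : (Matrix (Fin N) (Fin N) ℂ)ˣ) : Matrix (Fin N) (Fin N) ℂ) := by
        intro t ht
        rw [hval t, hAt_in t ht, mul_inv_rev, inv_inv]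
      have hinv' : ∀ t, dist t 0 < ε → (((h t x)⁻¹ : Matrix.specialUnitaryGroup (Fin N) ℂ) : Matrix (Fin N) (Fin N) ℂ) =
          ((Vf (expCfg η (A (t : ℂ))) j y * (Vf (expCfg η (A 0)) j y)⁻¹ : (Matrix (Fin N) (Fin N) ℂ)ˣ) : Matrix (Fin N) (Fin N) ℂ) := by
        intro t ht
        rw [coe_su_inv_eq_coe_units_inv (hval t), hAt_in t ht, mul_inv_rev, inv_inv]
      constructor
      · refine (Filter.EventuallyEq.differentiableAt_iff ?_).1 hqiR
        filter_upwards [Metric.ball_mem_nhds (0 : ℝ) hε] with t ht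
        exact (hval' t (Metric.mem_ball.1 ht)).symm
      · refine (Filter.EventuallyEq.differentiableAt_iff ?_).1 hqR
        filter_upwards [Metric.ball_mem_nhds (0 : ℝ) hε] with t ht
        exact (hinv' t (Metric.mem_ball.1 ht)).symm
  -- the fibre curve is bondwise differentiable at `0`
  have hγdiff : DifferentiableAt ℝ (fun (t : ℝ) (b : PBond (F.P K) 0) => ((γ t b : Matrix.specialUnitaryGroup (Fin N) ℂ) : Matrix (Fin N) (Fin N) ℂ)) 0 := by
    refine differentiableAt_pi.2 fun b => ?_
    have e : (fun t : ℝ => ((γ t b : Matrix.specialUnitaryGroup (Fin N) ℂ) : Matrix (Fin N) (Fin N) ℂ)) = fun t =>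
        ((h t b.src : Matrix.specialUnitaryGroup (Fin N) ℂ) : Matrix (Fin N) (Fin N) ℂ) * ((Ut t b : Matrix.specialUnitaryGroup (Fin N) ℂ) : Matrix (Fin N) (Fin N) ℂ) *
          (((h t b.tgt)⁻¹ : Matrix.specialUnitaryGroup (Fin N) ℂ) : Matrix (Fin N) (Fin N) ℂ) := funext fun t => coe_gaugeAct_apply' (h t) (Ut t) b
    rw [e]
    exact ((hhdiff b.src).1.mul (hUdiff b)).mul (hhdiff b.tgt).2
  -- criticality along the fibre curve, and gauge invariance of the action
  have hcritγ : HasDerivAt (fun t => wilsonAction4 (γ t)) 0 0 := hcrit γ hγ0 hγdiff fun t j c hj hc => hfib t j c hj hc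
  refine hcritγ.congr_of_eventuallyEq ?_
  filter_upwards [Metric.ball_mem_nhds (0 : ℝ) hε] with t ht
  show wilsonAction4 (U t) = wilsonAction4 (GaugeField.gaugeAct (h t) (Ut t))
  rw [B14Eq16FaddeevPopov.wilsonAction4_gaugeAct', hUt_in t (Metric.mem_ball.1 ht)]

/-! ## §3  From `Node00.IsCritOnFibre` -/

include hDk hcollar in
/-- ★★★ **THE SAME FROM THE RECORD's CRITICALITY PREDICATE**: if `U 0` is a critical configuration of (5) on the fibre `𝔅(𝔹, avgFamily (avOfRecord F N K) (U 0))`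
(`Node00.IsCritOnFibre`, curve form) for a determining set `𝔹` all of whose bonds are [B6] (2.3) index bonds of `D` of level `≤ k` (the (ii)-reading of ME #35), then along every
charted complex family with pinned double-bar data as in §2 the Wilson action of the `SU(N)` readings is stationary at `t = 0`.
[cite: Balaban1985Variational, (5)-(6) p.278, (156)-(157) p.302; Balaban1988Convergent, (2.10)-(2.12) p.256; Balaban1984PropagatorsII, (2.3) p.224] -/
theorem hasDerivAt_wilsonAction4_zero_of_flatChart_isCritOnFibre {w : ℕ → PBond (F.P K) 0 → ℝ} (hw : IsLevWeight (F.P K) k D w) {R : ℝ} (hR0 : 0 ≤ R)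
    (hR : 12800 * ((((F.P K).d + 2) * (F.P K).L : ℕ) : ℝ) ^ 2 * ((F.P K).L : ℝ) * R ≤ 1) (hRflat : 60800 * ((((F.P K).d + 2) * (F.P K).L : ℕ) : ℝ) ^ 2 * R ≤ 1)
    (hguard : 60 * ((((F.P K).d + 2) * (F.P K).L : ℕ) : ℝ) ^ 2 * ((F.P K).L : ℝ) * R < deltaSU (Fin N))
    (A : ℂ → PBond (F.P K) 0 → Matrix (Fin N) (Fin N) ℂ) (hAdiff : DifferentiableAt ℂ A 0)
    (hball : ∀ᶠ z in 𝓝 (0 : ℂ), ∀ b, w 1 b * ‖A z b‖ < R)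
    (hidx : ∀ᶠ z in 𝓝 (0 : ℂ), ∀ idx : BondIdx D,
      dbarIterU (idx.1.1 : ℕ) (expCfg ((((F.P K).L : ℝ)⁻¹) ^ k) (A z)) idx.1.2 = dbarIterU (idx.1.1 : ℕ) (expCfg ((((F.P K).L : ℝ)⁻¹) ^ k) (A 0)) idx.1.2)
    (U : ℝ → GaugeField (F.P K) 0 (Matrix.specialUnitaryGroup (Fin N) ℂ))
    (hU : ∀ᶠ t : ℝ in 𝓝 0, ∀ b, ((U t b : Matrix.specialUnitaryGroup (Fin N) ℂ) : Matrix (Fin N) (Fin N) ℂ) =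
      ((expCfg ((((F.P K).L : ℝ)⁻¹) ^ k) (A (↑t : ℂ)) b : (Matrix (Fin N) (Fin N) ℂ)ˣ) : _))
    (𝔹 : DetSet (F.P K)) (h𝔹 : ∀ (j : ℕ) (b : PBond (F.P K) j), b ∈ bondsOf (𝔹 j) → j ≤ k ∧ D.LamBond j b)
    (hcrit : IsCritOnFibre F N K 𝔹 (avgFamily (avOfRecord F N K) (U 0)) (U 0)) :
    HasDerivAt (fun t => wilsonAction4 (U t)) 0 0 := by
  refine hasDerivAt_wilsonAction4_zero_of_flatChart_critical F N K k D hDk hcollar hw hR0 hR hRflat hguard A hAdiff hball hidx U hU fun γ hγ0 hγd hγfib => ?_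
  refine (isCritOnFibre_iff_hasDerivAt_zero.1 hcrit) γ hγ0 hγd (Filter.Eventually.of_forall fun t j b hb => ?_)
  obtain ⟨hj, hlam⟩ := h𝔹 j b hb
  exact hγfib t j b hj hlam

end Transfer

/-! ## §4  The one-line junction with the (157) expansion (dag-n07-w1 `N07SocketOfChartedCriticality` §1∕§3 pattern, ♭ edition: stationarity as INPUT) -/

/-- **STATIONARITY + (157) ⇒ (127)**: if `s ↦ 𝔄(U s)` is stationary at `0` (§2) and splits as `q s + V s` along the line ((157): `q s = ½⟪A₀ + sδ, Δ₁(A₀ + sδ)⟫`,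
dag-n07-w1 ✓`hasDerivAt_inner_hessOpAt_line` gives `q′(0) = ⟪δ, Δ₁A₀⟫`; `V` = S4b's functional with `V′(0) = v = ⟨W, δ⟩`), then `q′(0) + V′(0) = 0` — the `h127rec` identity
`⟪δ, Δ₁A₀⟫ + ⟨W, δ⟩ = 0` with `T = 0` (uniqueness of derivatives). [cite: Balaban1985Variational, (127)-(128) p.297, (157) p.302] -/
theorem add_eq_zero_of_hasDerivAt_zero {f q V : ℝ → ℝ} {a v : ℝ} (hzero : HasDerivAt f 0 0) (h157 : ∀ s, f s = q s + V s) (hq : HasDerivAt q a 0)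
    (hV : HasDerivAt V v 0) : a + v = 0 := by
  have hsum : HasDerivAt f (a + v) 0 := by
    rw [show f = fun s => q s + V s from funext h157]
    exact hq.add hV
  exact hsum.unique hzero

end Summit.QuantumFields.YangMills.Theorems.K0Stub1FlatChartCriticalityTransfer

end
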